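import Summits.QuantumFields.GaugeBoot.ClassBRowSU2
import Summits.QuantumFields.GaugeBoot.ZdPairLoopClasses
import Summits.QuantumFields.GaugeBoot.MMRowSU2D4
import HarnessLib

/-!
# Rows as data for Class-B states, `D = 4`: the `SU(2)` loop-equation and trace rows on every Haar-shift, `ℤ⁴ ⋊ B₄`-invariant state (gauge-boot, Class-B rows, supplement 3)

HONEST FRAMING (cell `pub-gaugeboot`, page 1 of every file): the venture produces certified bounds
on lattice expectations at stated coupling, gauge group, dimension and torus size; NOT a mass gap,
NOT a continuum limit, NOT a string tension; NOT Yang–Mills-summit-bearing (barriers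
`FixedCouplingUltralocality`, `PerturbativeInvisibility`).

The `D = 4` twin of `ClassBRowSU2.lean` / `ClassBTraceRowSU2.lean` (as `MMRowSU2D4.lean` is the `D = 4` twin of
`MMRowSU2.lean`): for a finite measure `μ` on `LGConfig 4 SU(2)`,

  `rowSumZd4 μ β r = Σ_{(w, c0, c1) ∈ r} (c0 + c1·β/8) · ∫ W_0(w) dμ`   (`W = ½ Re tr`, `β` standard),

* `WZd4_canonW4`, `rowSumZd4_relabel` (translation- and `B₄`-invariant `μ`; `ZdLoopClasses.lean`);
* **`rowSumZd4_mmRowSU2D4`** — the single-link row of every closed marked word vanishes when `μ` moreover has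
  the one-link Haar-shift identity at tree coupling `β/2` (`IsHaarShiftState.loopEquation_su_two_loops`, six
  plaquettes through the link); `rowSumZd4_of_SDCheck4`;
* **`rowSumZd4_traceRowSU2D4`** — the `SU(2)` trace rows (kinematic: `su2_rawTrace_zd`, `pairExpZd_run`);
  `rowSumZd4_of_TRCheck4`;
* the **Class-B** corollaries `ClassBState.rowSumZd4_mmRowSU2D4 / _of_SDCheck4 / _traceRowSU2D4 / _of_TRCheck4`:
  both row families of the cell's `D = 4` `SU(2)` data modules (glyz-c1-4D, glyz-c2-4D, kz-L2-4D,
  kz-L2-rp-4D) hold verbatim on every Class-B state of `ℤ⁴`.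

Everything is `[folklore]`.
-/

noncomputable section

open MeasureTheory
open scoped Matrix
open Literature.Probability.LatticeModels (Site)
open Literature.MathematicalPhysics.QuantumLattice (LGConfig ZdEdge IsZdTranslationInvariant)

namespace Summit.QuantumFields.GaugeBoot

/-! ## The value of a `D = 4` row on a state of `ℤ⁴` -/

/-- The `SU(2)` loop variable of a measure `μ` on `ℤ⁴` configurations: `∫ W_0(w) dμ`. [folklore] -/
def WZd4 (μ : Measure (LGConfig 4 (SU 2))) (w : Word 4) : ℝ := ∫ U, wordLoopZd (suRep 2) (0 : Site 4) w U ∂μ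

/-- The value of a `D = 4` row on the state `μ`: `Σ (c0 + c1·β/8)·WZd4 μ label`. [folklore] -/
def rowSumZd4 (μ : Measure (LGConfig 4 (SU 2))) (β : ℝ) (r : ERow4) : ℝ :=
  (r.map fun t => (((t.2.1 : ℚ) : ℝ) + ((t.2.2 : ℚ) : ℝ) * (β / 8)) * WZd4 μ t.1).sum

variable (μ : Measure (LGConfig 4 (SU 2))) (β : ℝ)

/-- Unfolding lemma `rowSumZd4_nil`. [folklore] -/
@[simp] theorem rowSumZd4_nil : rowSumZd4 μ β [] = 0 := rfl

/-- Unfolding lemma `rowSumZd4_cons`. [folklore] -/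
@[simp] theorem rowSumZd4_cons (t : Word 4 × ℚ × ℚ) (r : ERow4) :
    rowSumZd4 μ β (t :: r) = (((t.2.1 : ℚ) : ℝ) + ((t.2.2 : ℚ) : ℝ) * (β / 8)) * WZd4 μ t.1 + rowSumZd4 μ β r := by
  simp [rowSumZd4]

/-- `rowSumZd4` is additive under concatenation. [folklore] -/
@[simp] theorem rowSumZd4_append (r r' : ERow4) :
    rowSumZd4 μ β (r ++ r') = rowSumZd4 μ β r + rowSumZd4 μ β r' := by
  simp [rowSumZd4, List.sum_append]

/-- `addTerm` adds the value of the term. [folklore] -/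
theorem rowSumZd4_addTerm (r : ERow4) (t : Word 4 × ℚ × ℚ) :
    rowSumZd4 μ β (r.addTerm t) = rowSumZd4 μ β r + rowSumZd4 μ β [t] := by
  induction r with
  | nil => simp [ERow4.addTerm]
  | cons u r ih =>
    simp only [ERow4.addTerm]
    split_ifs with h
    · simp only [rowSumZd4_cons, rowSumZd4_nil, h]
      push_cast
      ring
    · simp only [rowSumZd4_cons, ih, rowSumZd4_nil]
      ring

/-- Merging preserves the value. [folklore] -/
theorem rowSumZd4_merge (r : ERow4) : rowSumZd4 μ β r.merge = rowSumZd4 μ β r := by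
  suffices h : ∀ (acc : ERow4), rowSumZd4 μ β (r.foldl ERow4.addTerm acc) = rowSumZd4 μ β acc + rowSumZd4 μ β r by
    simpa [ERow4.merge] using h []
  induction r with
  | nil => intro acc; simp
  | cons t r ih =>
    intro acc
    simp only [List.foldl_cons, ih, rowSumZd4_addTerm, rowSumZd4_cons, rowSumZd4_nil]
    ring

/-- Cleaning preserves the value. [folklore] -/
theorem rowSumZd4_clean (r : ERow4) : rowSumZd4 μ β r.clean = rowSumZd4 μ β r := by
  induction r with
  | nil => simp [ERow4.clean]
  | cons t r ih =>
    simp only [ERow4.clean, List.filter_cons] at ih ⊢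
    split_ifs with h
    · simp only [rowSumZd4_cons, ih]
    · simp only [decide_eq_true_eq, not_or, not_not] at h
      simp only [rowSumZd4_cons, ih, h.1, h.2]
      push_cast
      ring

/-- `rowSumZd4` of a `flatMap` over `range n` is a `Finset.range` sum. [folklore] -/
theorem rowSumZd4_flatMap_range (f : ℕ → ERow4) :
    ∀ n : ℕ, rowSumZd4 μ β ((List.range n).flatMap f) = ∑ k ∈ Finset.range n, rowSumZd4 μ β (f k)
  | 0 => by simp
  | n + 1 => by
    rw [List.range_succ, List.flatMap_append, rowSumZd4_append, rowSumZd4_flatMap_range f n, Finset.sum_range_succ]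
    simp

/-! ## Relabelling: translation- and `B₄`-invariant states -/

section Relabel

variable {μ}
variable (hT : IsZdTranslationInvariant μ) (hP : ∀ σ : Equiv.Perm (Fin 4), MeasurePreserving (configPerm σ) μ μ)
  (hR : ∀ i : Fin 4, MeasurePreserving (configSiteReflect i) μ μ)
include hT hP hR

/-- **Relabelling by ANY witness code preserves the loop variable** (`D = 4`). [folklore] -/
theorem WZd4_canonW4 (c : ℕ) (w : Word 4) (hw : Word.disp w = 0) : WZd4 μ (w.canonW4 c) = WZd4 μ w := by
  unfold WZd4 Word.canonW4
  exact (integral_wordLoopZd_canon (suRep 2) (continuous_suRep 2) hT hP hR _ _ _ _ _ (Word.disp_acts _ hw)).symm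

/-- Relabelling one term preserves the value. [folklore] -/
theorem rowSumZd4_relabelTerm (c : ℕ) (t : Word 4 × ℚ × ℚ) :
    rowSumZd4 μ β [ERow4.relabelTerm c t] = rowSumZd4 μ β [t] := by
  unfold ERow4.relabelTerm
  split_ifs with h
  · simp only [rowSumZd4_cons, rowSumZd4_nil, WZd4_canonW4 hT hP hR c t.1 h]
  · rfl

/-- Relabelling preserves the value, for EVERY code list. [folklore] -/
theorem rowSumZd4_relabel : ∀ (cs : List ℕ) (r : ERow4), rowSumZd4 μ β (ERow4.relabel cs r) = rowSumZd4 μ β r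
  | _, [] => by simp [ERow4.relabel]
  | [], t :: r => by
    have ht := rowSumZd4_relabelTerm β hT hP hR 0 t
    simp only [rowSumZd4_cons, rowSumZd4_nil, add_zero] at ht
    rw [ERow4.relabel, rowSumZd4_cons, rowSumZd4_cons, rowSumZd4_relabel [] r, ht]
  | c :: cs, t :: r => by
    have ht := rowSumZd4_relabelTerm β hT hP hR c t
    simp only [rowSumZd4_cons, rowSumZd4_nil, add_zero] at ht
    rw [ERow4.relabel, rowSumZd4_cons, rowSumZd4_cons, rowSumZd4_relabel cs r, ht]

end Relabel

/-! ## Single-link rows: Haar-shift states -/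

section Raw

variable {μ} [IsFiniteMeasure μ]

/-- **The raw terms sum to zero** on a Haar-shift state of `ℤ⁴` at tree coupling `β/2` (six plaquettes
through the marked link), for every closed marked word. [folklore] -/
theorem rowSumZd4_sdTermsRaw4 (hμ : IsHaarShiftState (suRep 2) (β / 2) μ) (X : Word 4) (hX : Word.disp X = 0) :
    rowSumZd4 μ β (sdTermsRaw4 X) = 0 := by
  have h := hμ.loopEquation_su_two_loops μ (0 : Site 4) 0 X (endpointZd_eq_self_of_disp 0 hX)
  have hW : ∀ v : Word 4, ∫ U, wordLoopZd (suRep 2) (0 : Site 4) v U ∂μ = WZd4 μ v := fun v => rfl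
  simp only [hW, univ_erase_zero_fin_four] at h
  rw [Finset.sum_insert (show (1 : Fin 4) ∉ ({2, 3} : Finset (Fin 4)) by decide),
    Finset.sum_pair (show (2 : Fin 4) ≠ 3 by decide), Finset.sum_filter, Finset.sum_filter,
    ← Finset.sum_sub_distrib] at h
  simp only [Fintype.sum_bool] at h
  have hat : ∀ k, rowSumZd4 μ β (sdTermsAt4 X k) = (1 / 4 : ℝ) *
      ((if X.fwdOccZ 0 k then WZd4 μ X + 2 * WZd4 μ (X.take k ++ Word.reverse (X.drop k)) else 0) -
        (if X.bwdOccZ 0 k then WZd4 μ X + 2 * WZd4 μ (X.take (k + 1) ++ Word.reverse (X.drop (k + 1)))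
          else 0)) := by
    intro k
    unfold sdTermsAt4
    split_ifs <;> simp only [rowSumZd4_append, rowSumZd4_cons, rowSumZd4_nil, List.nil_append, List.append_nil] <;>
      push_cast <;> ring
  rw [sdTermsRaw4, rowSumZd4_append, rowSumZd4_append, rowSumZd4_append, rowSumZd4_flatMap_range]
  simp only [hat]
  rw [← Finset.mul_sum]
  simp only [sdPlaqTerms4, rowSumZd4_cons, rowSumZd4_nil]
  push_cast at h ⊢
  linear_combination (1 / 4 : ℝ) * h

/-- **Soundness of the computed `D = 4` row on a state of `ℤ⁴`.** [folklore] -/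
theorem rowSumZd4_mmRowSU2D4 (hμ : IsHaarShiftState (suRep 2) (β / 2) μ) (hT : IsZdTranslationInvariant μ)
    (hP : ∀ σ : Equiv.Perm (Fin 4), MeasurePreserving (configPerm σ) μ μ)
    (hR : ∀ i : Fin 4, MeasurePreserving (configSiteReflect i) μ μ) (X : Word 4) (cs : List ℕ)
    (hX : Word.disp X = 0) : rowSumZd4 μ β (mmRowSU2D4 X cs) = 0 := by
  rw [mmRowSU2D4, rowSumZd4_clean, rowSumZd4_merge, rowSumZd4_relabel β hT hP hR, rowSumZd4_sdTermsRaw4 β hμ X hX]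

/-- **All rows of a checked `D = 4` SD family vanish** on such a state. [folklore] -/
theorem rowSumZd4_of_SDCheck4 (hμ : IsHaarShiftState (suRep 2) (β / 2) μ) (hT : IsZdTranslationInvariant μ)
    (hP : ∀ σ : Equiv.Perm (Fin 4), MeasurePreserving (configPerm σ) μ μ)
    (hR : ∀ i : Fin 4, MeasurePreserving (configSiteReflect i) μ μ) {B : ℕ}
    {rs : List (Word 4 × List ℕ)} (h : SDCheck4 B rs = true) :
    ∀ r ∈ rs, rowSumZd4 μ β (mmRowSU2D4 r.1 r.2) = 0 := by
  intro r hr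
  have h' := List.all_eq_true.1 h r hr
  simp only [Bool.and_eq_true, decide_eq_true_eq] at h'
  exact rowSumZd4_mmRowSU2D4 β hμ hT hP hR r.1 r.2 h'.1

/-! ## Trace rows: invariant states -/

/-- **Soundness of the `D = 4` trace row on a state of `ℤ⁴`** (kinematic: no Haar-shift identity needed).
[folklore] -/
theorem rowSumZd4_traceRowSU2D4 (hT : IsZdTranslationInvariant μ)
    (hP : ∀ σ : Equiv.Perm (Fin 4), MeasurePreserving (configPerm σ) μ μ)
    (hR : ∀ i : Fin 4, MeasurePreserving (configSiteReflect i) μ μ) (C₁ C₂ D₁ D₂ : Word 4)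
    (sa sb cs : List ℕ) (h : trOK4 C₁ C₂ D₁ D₂ sa sb = true) :
    rowSumZd4 μ β (traceRowSU2D4 C₁ C₂ D₁ D₂ cs) = 0 := by
  simp only [trOK4, Bool.and_eq_true, Bool.or_eq_true, decide_eq_true_eq] at h
  obtain ⟨⟨⟨⟨⟨⟨h₁, h₂⟩, h₃⟩, h₄⟩, ha⟩, hb⟩, hrun⟩ := h
  have ea := su2_rawTrace_zd μ 0 C₁ C₂ h₁ h₂
  have eb := su2_rawTrace_zd μ 0 D₁ D₂ h₃ h₄
  have hW : ∀ v : Word 4, ∫ U, wordLoopZd (suRep 2) (0 : Fin 4 → ℤ) v U ∂μ = WZd4 μ v := fun v => rfl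
  simp only [hW] at ea eb
  have pa := pairExpZd_run (suRep 2) (continuous_suRep 2) hT hP (hR 0) (pmDecode4 sa) (pairAt04 C₁ C₂) ha
  have pb := pairExpZd_run (suRep 2) (continuous_suRep 2) hT hP (hR 0) (pmDecode4 sb) (pairAt04 D₁ D₂) hb
  have hpq : pairExpZd (suRep 2) μ (⟨0, C₁⟩ : PLoop 4) ⟨0, C₂⟩ = pairExpZd (suRep 2) μ (⟨0, D₁⟩ : PLoop 4) ⟨0, D₂⟩ := by
    change pairExpZd (suRep 2) μ (pairAt04 C₁ C₂).1 (pairAt04 C₁ C₂).2 =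
      pairExpZd (suRep 2) μ (pairAt04 D₁ D₂).1 (pairAt04 D₁ D₂).2
    rw [← pa, ← pb]
    rcases hrun with e | e
    · rw [e]
    · rw [e, Prod.fst_swap, Prod.snd_swap, pairExpZd_comm]
  rw [traceRowSU2D4, rowSumZd4_clean, rowSumZd4_merge, rowSumZd4_relabel β hT hP hR]
  simp only [rowSumZd4_cons, rowSumZd4_nil]
  change 2 * pairExpZd (suRep 2) μ (⟨0, C₁⟩ : PLoop 4) ⟨0, C₂⟩ = _ at ea
  change 2 * pairExpZd (suRep 2) μ (⟨0, D₁⟩ : PLoop 4) ⟨0, D₂⟩ = _ at eb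
  push_cast
  linear_combination eb - ea + 2 * hpq

/-- **All rows of a checked `D = 4` trace family vanish** on such a state. [folklore] -/
theorem rowSumZd4_of_TRCheck4 (hT : IsZdTranslationInvariant μ)
    (hP : ∀ σ : Equiv.Perm (Fin 4), MeasurePreserving (configPerm σ) μ μ)
    (hR : ∀ i : Fin 4, MeasurePreserving (configSiteReflect i) μ μ) {ts : List TrData4}
    (h : TRCheck4 ts = true) : ∀ t ∈ ts, rowSumZd4 μ β t.row = 0 := by
  intro t ht
  exact rowSumZd4_traceRowSU2D4 β hT hP hR t.C₁ t.C₂ t.D₁ t.D₂ t.sa t.sb t.cs (List.all_eq_true.1 h t ht)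

end Raw

/-! ## Class-B states of `ℤ⁴` -/

section ClassB

/-- **Every `D = 4` `mm_row` vanishes on every Class-B state** (`SU(2)`, `ℤ⁴`, tree coupling `β/2`). [folklore] -/
theorem ClassBState.rowSumZd4_mmRowSU2D4 {β : ℝ} (ω : ClassBState 4 (suRep 2) (β / 2)) (X : Word 4) (cs : List ℕ)
    (hX : Word.disp X = 0) : rowSumZd4 ω.μ β (mmRowSU2D4 X cs) = 0 := by
  haveI := ω.isProbabilityMeasure
  exact _root_.Summit.QuantumFields.GaugeBoot.rowSumZd4_mmRowSU2D4 β ω.haarShift ω.translationInvariant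
    ω.permInvariant ω.reflectInvariant X cs hX

/-- **All rows of a checked `D = 4` SD family vanish on every Class-B state.** [folklore] -/
theorem ClassBState.rowSumZd4_of_SDCheck4 {β : ℝ} (ω : ClassBState 4 (suRep 2) (β / 2)) {B : ℕ}
    {rs : List (Word 4 × List ℕ)} (h : SDCheck4 B rs = true) :
    ∀ r ∈ rs, rowSumZd4 ω.μ β (mmRowSU2D4 r.1 r.2) = 0 := by
  haveI := ω.isProbabilityMeasure
  exact _root_.Summit.QuantumFields.GaugeBoot.rowSumZd4_of_SDCheck4 β ω.haarShift ω.translationInvariant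
    ω.permInvariant ω.reflectInvariant h

/-- **Every checked `D = 4` trace row vanishes on every Class-B state.** [folklore] -/
theorem ClassBState.rowSumZd4_traceRowSU2D4 (β : ℝ) {β' : ℝ} (ω : ClassBState 4 (suRep 2) β')
    (C₁ C₂ D₁ D₂ : Word 4) (sa sb cs : List ℕ) (h : trOK4 C₁ C₂ D₁ D₂ sa sb = true) :
    rowSumZd4 ω.μ β (traceRowSU2D4 C₁ C₂ D₁ D₂ cs) = 0 := by
  haveI := ω.isProbabilityMeasure
  exact _root_.Summit.QuantumFields.GaugeBoot.rowSumZd4_traceRowSU2D4 β ω.translationInvariant ω.permInvariant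
    ω.reflectInvariant C₁ C₂ D₁ D₂ sa sb cs h

/-- **All rows of a checked `D = 4` trace family vanish on every Class-B state.** [folklore] -/
theorem ClassBState.rowSumZd4_of_TRCheck4 (β : ℝ) {β' : ℝ} (ω : ClassBState 4 (suRep 2) β') {ts : List TrData4}
    (h : TRCheck4 ts = true) : ∀ t ∈ ts, rowSumZd4 ω.μ β t.row = 0 := by
  haveI := ω.isProbabilityMeasure
  exact _root_.Summit.QuantumFields.GaugeBoot.rowSumZd4_of_TRCheck4 β ω.translationInvariant ω.permInvariant
    ω.reflectInvariant h

end ClassB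

end Summit.QuantumFields.GaugeBoot

end
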